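import Mathlib
import HarnessLib

/-!
# CubeDefectPlaquettes — the geometry of the OBC→PBC defectCube defect: which temporal plaquettes carry
# one or two defect links, how many of each (`2s·n^{s−1}` and `s(n−1)n^{s−1}`), and E7's protocol
# weight `6λ n_dof` with its one-link boundary term `6L_d²(1 − λ)`

HONEST FRAMING: exact (Metropolis-corrected) sampling algorithms for lattice gauge theory;
figures of merit are autocorrelation/cost numbers at stated couplings and volumes; no
continuum-physics claim.

Venture `LatticeQCDFlow` (cell pub-lqcd), topic `Scaling`; FANOUT row 19 (`su2-snf`, GEN-4: family
C, levers `defect.size` `L_d ∈ {2, 3, 4}`, `n_dof` collapse check E-1 of CARD-su2-snf).  OUR WORK,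
finite combinatorics in `ℤ^s`; nothing is cited as a fact.  It supplies the item
`Exactness/PTBCSwapEnergy` lists under "Not here": «which plaquettes of the torus have `m(p) = k`
for the `L_d³` defectCube defect (geometry)» — for the defect of Bonanno et al. (E7, arXiv:2510.25704
eq. (2.9)–(2.10)) and of rows 19 / 21 / 22: the TEMPORAL links `U_0(y)` of ONE time slice with
spatial feet `y` in the defectCube `[0, n)^s` (`s = d − 1 = 3`, `n = L_d`), K-product plaquette weight
`K_p = λ^{m(p)}`, `m(p)` = number of defect links of `p`.  Only the temporal plaquettes
`P_{0i}(y)` (`i` spatial, lower spatial corner `y`) contain temporal links of the slice, namely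
`U_0(y)` and `U_0(y + e_i)`; so `m(y, i) = [y ∈ defectCube] + [y + e_i ∈ defectCube] ∈ {0, 1, 2}`
(`defectLinks`, `defectLinks_le_two`).  We work in `ℤ^s` (the slice of a torus of spatial extent
`L > n` embeds the picture injectively; that embedding is not typed here).

## Content (all proved; `defectCube s n = [0,n)^s`, `|defectCube| = n^s = n_dof`: `card_defectCube`)

* `defectCube_filter_shift_eq`, `card_defectCube_filter_shift` — the sites of the defectCube whose forward
  `i`-neighbour is in the defectCube form the box with the `i`-th side shortened: `(n − 1)·n^{s−1}` of them;
* `twoLinkCorners s n i` / `oneLinkCorners s n i` (lower corners of the two-link / one-link plaquettes in direction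
  `i`; `mem_twoLinkCorners_iff_defectLinks`, `mem_oneLinkCorners_iff_defectLinks`: they are exactly `m = 2` /
  `m = 1`); **`card_twoLinkCorners`** `= (n − 1)·n^{s−1}`; `card_defectCube_innerFace`, `card_defectCube_outerFace` (`n^{s−1}`
  each); **`card_oneLinkCorners`** `= 2·n^{s−1}`;
* totals over directions: **`sum_card_twoLinkCorners`** `= s(n − 1)n^{s−1}`, **`sum_card_oneLinkCorners`**
  `= 2s·n^{s−1}`, and the incidence identity **`two_mul_twoLinkCorners_add_oneLinkCorners`**:
  `2·#two + #one = 2s·n^s` — each of the `n^s` defect links lies in exactly `2s` temporal plaquettes;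
* E7's protocol weight: `defectProtocolWeight_eq` — `Σ_p ∂_λ K_p = 2λ·#two + #one
  = 2s n^{s−1}(λ(n − 1) + 1)`, i.e. for `s = 3`: `6λ L_d³ + 6 L_d²(1 − λ)` = the printed
  `6λ n_dof` of E7 eq. (3.5) ("we ignore the plaquettes containing only one defect link") PLUS a
  one-link boundary term of relative size `(1 − λ)/(λ L_d)`, dominant early in the protocol;
  `integral_defectProtocolWeight` — its protocol average `s n^{s−1}(n + 1) = s·n_dof·(1 + 1/n)`;
  `e7_defect_counts`, `e7_integral_defectProtocolWeight` (`s = 3`: `3L_d²(L_d − 1)`, `6L_d²`, `6L_d³`,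
  `3 n_dof (1 + 1/L_d)`).

Reading (value-free; the counts are exact, the dynamics is not modelled here): per unit plaquette
response, the work-generating weight per degree of freedom carries the finite-defect factor
`1 + 1/L_d` (`3/2, 4/3, 5/4` at `L_d = 2, 3, 4`), so an `n_dof = L_d³` collapse of `⟨W_d⟩` or of
`−log ESS` can only be approximate at small `L_d`, with the SMALLER defect showing the LARGER `k′`
per `L_d³` — the direction of row 19's F1 reading (`k′_W(L_d = 2) > k′_W(L_d = 3)`, CARD E-1
within 2σ) and of E7's "qualitative" caveat.  NOT CLAIMED: equal response of one- and two-link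
plaquettes (false in general), any value of `k′`, the torus embedding, the PTBC swap statistics.
-/

namespace Summit.Ventures.LatticeQCDFlow.Scaling

open Finset

variable {s : ℕ}

/-- The spatial defectCube `[0, n)^s ⊂ ℤ^s`: the sites `y` of the defect time slice whose temporal link
`U_0(y)` is a defect link (E7: `0 ≤ y_1, y_2, y_3 < L_d`). -/
noncomputable def defectCube (s n : ℕ) : Finset (Fin s → ℤ) :=
  Fintype.piFinset fun _ => Finset.Ico (0 : ℤ) n

/-- The unit lattice vector in spatial direction `i`. -/
def latticeUnitVec (i : Fin s) : Fin s → ℤ := Pi.single i 1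

/-- Membership in the cube: all coordinates in `[0, n)`. -/
theorem mem_defectCube {n : ℕ} {y : Fin s → ℤ} : y ∈ defectCube s n ↔ ∀ j, 0 ≤ y j ∧ y j < n := by
  simp [defectCube, Fintype.mem_piFinset]

/-- `|defectCube| = n^s` (= `n_dof`, the number of defect links). -/
theorem card_defectCube (s n : ℕ) : (defectCube s n).card = n ^ s := by
  simp [defectCube, Fintype.card_piFinset]

/-- The sites `y` of the defectCube whose forward neighbour `y + e_i` is also in the defectCube are the defectCube
with its `i`-th range shortened by one. -/
theorem defectCube_filter_shift_eq (n : ℕ) (i : Fin s) :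
    (defectCube s n).filter (fun y => y + latticeUnitVec i ∈ defectCube s n)
      = Fintype.piFinset (Function.update (fun _ : Fin s => Finset.Ico (0 : ℤ) n) i
          (Finset.Ico (0 : ℤ) (n - 1 : ℤ))) := by
  ext y
  simp only [mem_filter, mem_defectCube, Fintype.mem_piFinset]
  constructor
  · rintro ⟨hy, hy'⟩ j
    by_cases hj : j = i
    · subst hj
      rw [Function.update_self, mem_Ico]
      have h1 := hy j
      have h2 := hy' j
      simp only [latticeUnitVec, Pi.add_apply, Pi.single_eq_same] at h2
      exact ⟨h1.1, by linarith [h2.2]⟩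
    · rw [Function.update_of_ne hj, mem_Ico]
      exact hy j
  · intro h
    constructor
    · intro j
      by_cases hj : j = i
      · subst hj
        have := h j
        rw [Function.update_self, mem_Ico] at this
        exact ⟨this.1, by linarith [this.2]⟩
      · have := h j
        rw [Function.update_of_ne hj, mem_Ico] at this
        exact this
    · intro j
      by_cases hj : j = i
      · subst hj
        have := h j
        rw [Function.update_self, mem_Ico] at this
        simp only [latticeUnitVec, Pi.add_apply, Pi.single_eq_same]
        exact ⟨by linarith [this.1], by linarith [this.2]⟩
      · have := h j
        rw [Function.update_of_ne hj, mem_Ico] at this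
        simp only [latticeUnitVec, Pi.add_apply, Pi.single_eq_of_ne hj, add_zero]
        exact this

/-- **Two-link plaquettes in one direction.**  The number of sites `y` of the defectCube with `y + e_i`
also in the defectCube — the temporal plaquettes `P_{0i}(y)` carrying TWO defect links — is
`(n − 1) · n^{s−1}`. -/
theorem card_defectCube_filter_shift {n : ℕ} (hn : 1 ≤ n) (i : Fin s) :
    ((defectCube s n).filter (fun y => y + latticeUnitVec i ∈ defectCube s n)).card = (n - 1) * n ^ (s - 1) := by
  rw [defectCube_filter_shift_eq, Fintype.card_piFinset]
  rw [← Finset.mul_prod_erase univ _ (mem_univ i), Function.update_self]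
  have h : ∀ j ∈ univ.erase i, (Function.update (fun _ : Fin s => Finset.Ico (0 : ℤ) n) i
      (Finset.Ico (0 : ℤ) (n - 1 : ℤ)) j).card = n := by
    intro j hj
    rw [Function.update_of_ne (ne_of_mem_erase hj)]
    simp
  rw [prod_congr rfl h, prod_const, card_erase_of_mem (mem_univ i), card_univ, Fintype.card_fin]
  congr 1
  rw [Int.card_Ico]
  have : ((n : ℤ) - 1 - 0) = ((n - 1 : ℕ) : ℤ) := by push_cast [Nat.cast_sub hn]; ring
  rw [this, Int.toNat_natCast]


/-! ## The temporal plaquettes of the slice touching the defect, by number of defect links -/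

/-- The number of defect links of the temporal plaquette `P_{0i}(y)` of the defect time slice (its
two temporal links sit at the spatial sites `y` and `y + e_i`):
`m(y, i) = [y ∈ defectCube] + [y + e_i ∈ defectCube]` — the exponent of the printed K-product weight
`K_p = λ^{m(p)}` (E7 eq. (2.10); row 22's `kProductWeight`). -/
noncomputable def defectLinks (s n : ℕ) (y : Fin s → ℤ) (i : Fin s) : ℕ :=
  (if y ∈ defectCube s n then 1 else 0) + (if y + latticeUnitVec i ∈ defectCube s n then 1 else 0)

/-- `m ≤ 2`: a plaquette has two temporal links. -/
theorem defectLinks_le_two (s n : ℕ) (y : Fin s → ℤ) (i : Fin s) : defectLinks s n y i ≤ 2 := by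
  unfold defectLinks
  split_ifs <;> simp

/-- Lower corners `y` of the TWO-LINK plaquettes `P_{0i}(y)` (weight `λ²`): `y` and `y + e_i` in the
defectCube. -/
noncomputable def twoLinkCorners (s n : ℕ) (i : Fin s) : Finset (Fin s → ℤ) :=
  (defectCube s n).filter fun y => y + latticeUnitVec i ∈ defectCube s n

/-- Lower corners `y` of the ONE-LINK plaquettes `P_{0i}(y)` (weight `λ`): exactly one of `y`,
`y + e_i` in the defectCube — the inner face `y ∈ defectCube, y + e_i ∉ defectCube` and the outer face
`y ∉ defectCube, y + e_i ∈ defectCube`. -/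
noncomputable def oneLinkCorners (s n : ℕ) (i : Fin s) : Finset (Fin s → ℤ) :=
  ((defectCube s n).filter fun y => y + latticeUnitVec i ∉ defectCube s n)
    ∪ (((defectCube s n).image fun z => z - latticeUnitVec i).filter fun y => y ∉ defectCube s n)

/-- `y` is a backward translate of a cube site iff its forward neighbour `y + e_i` is in the cube. -/
theorem mem_defectCube_image_sub_iff {n : ℕ} (i : Fin s) {y : Fin s → ℤ} :
    y ∈ (defectCube s n).image (fun z => z - latticeUnitVec i) ↔ y + latticeUnitVec i ∈ defectCube s n := by
  constructor
  · rintro h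
    obtain ⟨z, hz, rfl⟩ := mem_image.mp h
    simpa using hz
  · intro h
    exact mem_image.mpr ⟨y + latticeUnitVec i, h, by simp⟩

/-- Membership in `twoLinkCorners`: both feet in the cube. -/
theorem mem_twoLinkCorners_iff {n : ℕ} {i : Fin s} {y : Fin s → ℤ} :
    y ∈ twoLinkCorners s n i ↔ y ∈ defectCube s n ∧ y + latticeUnitVec i ∈ defectCube s n := by
  simp [twoLinkCorners]

/-- Membership in `oneLinkCorners`: exactly one foot in the cube. -/
theorem mem_oneLinkCorners_iff {n : ℕ} {i : Fin s} {y : Fin s → ℤ} :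
    y ∈ oneLinkCorners s n i ↔ (y ∈ defectCube s n ∧ y + latticeUnitVec i ∉ defectCube s n)
      ∨ (y ∉ defectCube s n ∧ y + latticeUnitVec i ∈ defectCube s n) := by
  simp only [oneLinkCorners, mem_union, mem_filter, mem_defectCube_image_sub_iff]
  tauto

/-- The classification agrees with the link count: `m = 2` exactly on `twoLinkCorners`. -/
theorem mem_twoLinkCorners_iff_defectLinks {n : ℕ} {i : Fin s} {y : Fin s → ℤ} :
    y ∈ twoLinkCorners s n i ↔ defectLinks s n y i = 2 := by
  rw [mem_twoLinkCorners_iff, defectLinks]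
  split_ifs <;> simp_all

/-- … and `m = 1` exactly on `oneLinkCorners`. -/
theorem mem_oneLinkCorners_iff_defectLinks {n : ℕ} {i : Fin s} {y : Fin s → ℤ} :
    y ∈ oneLinkCorners s n i ↔ defectLinks s n y i = 1 := by
  rw [mem_oneLinkCorners_iff, defectLinks]
  split_ifs <;> simp_all

/-- **Two-link plaquettes per direction: `(n − 1)·n^{s−1}`.** -/
theorem card_twoLinkCorners {n : ℕ} (hn : 1 ≤ n) (i : Fin s) :
    (twoLinkCorners s n i).card = (n - 1) * n ^ (s - 1) :=
  card_defectCube_filter_shift hn i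

/-- The inner face: `n^{s−1}` sites of the defectCube have their forward neighbour outside. -/
theorem card_defectCube_innerFace {n : ℕ} (hn : 1 ≤ n) (i : Fin s) :
    ((defectCube s n).filter fun y => y + latticeUnitVec i ∉ defectCube s n).card = n ^ (s - 1) := by
  have hs : s - 1 + 1 = s := Nat.sub_add_cancel (Nat.one_le_of_lt i.pos)
  have h := Finset.card_filter_add_card_filter_not (s := defectCube s n)
    (fun y => y + latticeUnitVec i ∈ defectCube s n)
  rw [card_defectCube, card_defectCube_filter_shift hn i] at h
  have hpow : n ^ s = n * n ^ (s - 1) := by rw [← pow_succ', hs]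
  -- (n-1) n^{s-1} + x = n^s
  have : (n - 1) * n ^ (s - 1) + n ^ (s - 1) = n ^ s := by
    rw [hpow]
    have : n - 1 + 1 = n := Nat.sub_add_cancel hn
    calc (n - 1) * n ^ (s - 1) + n ^ (s - 1) = (n - 1 + 1) * n ^ (s - 1) := by ring
      _ = n * n ^ (s - 1) := by rw [this]
  omega

/-- The outer face: `n^{s−1}` sites outside the defectCube have their forward neighbour inside. -/
theorem card_defectCube_outerFace {n : ℕ} (hn : 1 ≤ n) (i : Fin s) :
    (((defectCube s n).image fun z => z - latticeUnitVec i).filter fun y => y ∉ defectCube s n).card = n ^ (s - 1) := by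
  have hs : s - 1 + 1 = s := Nat.sub_add_cancel (Nat.one_le_of_lt i.pos)
  have himg : ((defectCube s n).image fun z => z - latticeUnitVec i).card = n ^ s := by
    rw [card_image_of_injective _ (sub_left_injective), card_defectCube]
  have hin : (((defectCube s n).image fun z => z - latticeUnitVec i).filter fun y => y ∈ defectCube s n)
      = twoLinkCorners s n i := by
    ext y
    simp only [mem_filter, mem_defectCube_image_sub_iff, mem_twoLinkCorners_iff]
    tauto
  have h := Finset.card_filter_add_card_filter_not
    (s := (defectCube s n).image fun z => z - latticeUnitVec i) (fun y => y ∈ defectCube s n)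
  rw [himg, hin, card_twoLinkCorners hn i] at h
  have hpow : n ^ s = n * n ^ (s - 1) := by rw [← pow_succ', hs]
  have : (n - 1) * n ^ (s - 1) + n ^ (s - 1) = n ^ s := by
    rw [hpow]
    have : n - 1 + 1 = n := Nat.sub_add_cancel hn
    calc (n - 1) * n ^ (s - 1) + n ^ (s - 1) = (n - 1 + 1) * n ^ (s - 1) := by ring
      _ = n * n ^ (s - 1) := by rw [this]
  simpa using (by omega : (((defectCube s n).image fun z => z - latticeUnitVec i).filter
    fun y => y ∉ defectCube s n).card = n ^ (s - 1))

/-- **One-link plaquettes per direction: `2·n^{s−1}`** (inner face + outer face). -/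
theorem card_oneLinkCorners {n : ℕ} (hn : 1 ≤ n) (i : Fin s) :
    (oneLinkCorners s n i).card = 2 * n ^ (s - 1) := by
  rw [oneLinkCorners, card_union_of_disjoint, card_defectCube_innerFace hn i, card_defectCube_outerFace hn i]
  · ring
  · rw [disjoint_left]
    intro y hy hy'
    exact (mem_filter.mp hy').2 (mem_filter.mp hy).1

/-! ## Totals over the `s` spatial directions, and the protocol weight -/

/-- **Total two-link plaquettes: `s·(n−1)·n^{s−1}`** (E7, `s = 3`: `3L_d²(L_d − 1)`). -/
theorem sum_card_twoLinkCorners {n : ℕ} (hn : 1 ≤ n) :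
    ∑ i : Fin s, (twoLinkCorners s n i).card = s * ((n - 1) * n ^ (s - 1)) := by
  simp [card_twoLinkCorners hn]

/-- **Total one-link plaquettes: `2s·n^{s−1}`** (E7, `s = 3`: `6L_d²` — the plaquettes the
heuristic of E7 §3.1 drops, "we ignore the plaquettes containing only one defect link"). -/
theorem sum_card_oneLinkCorners {n : ℕ} (hn : 1 ≤ n) :
    ∑ i : Fin s, (oneLinkCorners s n i).card = s * (2 * n ^ (s - 1)) := by
  simp [card_oneLinkCorners hn]

/-- **Link–plaquette incidence**: `2·#(two-link) + #(one-link) = 2s·n^s = 2s·n_dof` — every one of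
the `n^s` defect links lies in exactly `2s` temporal plaquettes of the slice. -/
theorem two_mul_twoLinkCorners_add_oneLinkCorners {n : ℕ} (hn : 1 ≤ n) (hs : 1 ≤ s) :
    2 * ∑ i : Fin s, (twoLinkCorners s n i).card + ∑ i : Fin s, (oneLinkCorners s n i).card = 2 * s * n ^ s := by
  rw [sum_card_twoLinkCorners hn, sum_card_oneLinkCorners hn]
  have hpow : n ^ s = n * n ^ (s - 1) := by
    rw [← pow_succ', Nat.sub_add_cancel hs]
  have h1 : n - 1 + 1 = n := Nat.sub_add_cancel hn
  rw [hpow]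
  calc 2 * (s * ((n - 1) * n ^ (s - 1))) + s * (2 * n ^ (s - 1))
      = 2 * s * ((n - 1 + 1) * n ^ (s - 1)) := by ring
    _ = 2 * s * (n * n ^ (s - 1)) := by rw [h1]

/-- **The protocol weight of E7's linear family** `K_p(λ) = λ^{m(p)}`: the derivative of the defect
action in `λ`, summed over the slice with unit plaquette values, is
`w(λ) = Σ_p m(p) λ^{m(p)−1} = 2λ·#(two-link) + #(one-link) = 2s n^{s−1}·(λ(n − 1) + 1)` —
E7's `6 λ n_dof` (eq. (3.5), `s = 3`) plus the one-link boundary term `6 L_d²(1 − λ)`. -/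
theorem defectProtocolWeight_eq {n : ℕ} (hn : 1 ≤ n) (c : ℝ) :
    2 * c * (∑ i : Fin s, (twoLinkCorners s n i).card : ℕ) + (∑ i : Fin s, (oneLinkCorners s n i).card : ℕ)
      = 2 * s * (n : ℝ) ^ (s - 1) * (c * (n - 1) + 1) := by
  rw [sum_card_twoLinkCorners hn, sum_card_oneLinkCorners hn]
  push_cast [Nat.cast_sub hn]
  ring

/-- Its protocol average: `∫₀¹ w(λ) dλ = s·n^{s−1}·(n + 1) = s·n^s·(1 + 1/n)` — E7's `3 n_dof`
(their eq. (3.7)–(3.8), two-link plaquettes only) times the finite-defect factor `1 + 1/L_d`. -/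
theorem integral_defectProtocolWeight {n : ℕ} (hn : 1 ≤ n) :
    ∫ c in (0 : ℝ)..1, (2 * c * (∑ i : Fin s, (twoLinkCorners s n i).card : ℕ)
        + (∑ i : Fin s, (oneLinkCorners s n i).card : ℕ))
      = s * (n : ℝ) ^ (s - 1) * (n + 1) := by
  simp_rw [defectProtocolWeight_eq hn]
  have : ∀ c : ℝ, 2 * (s : ℝ) * (n : ℝ) ^ (s - 1) * (c * (n - 1) + 1)
      = (2 * s * (n : ℝ) ^ (s - 1) * (n - 1)) * c + 2 * s * (n : ℝ) ^ (s - 1) := by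
    intro c; ring
  simp_rw [this]
  rw [intervalIntegral.integral_add (by apply Continuous.intervalIntegrable; fun_prop)
    (by apply Continuous.intervalIntegrable; fun_prop), intervalIntegral.integral_const_mul,
    integral_id, intervalIntegral.integral_const]
  simp only [one_pow, ne_eq, OfNat.ofNat_ne_zero, not_false_eq_true, zero_pow, sub_zero, one_smul]
  ring


/-! ## E7's geometry: `s = 3` spatial directions, defectCube side `L_d` -/

/-- E7 / rows 19, 21, 22 (`d = 4`, defect = the temporal links over an `L_d³` spatial defectCube of one
time slice): `3·L_d²·(L_d − 1)` two-link plaquettes, `6·L_d²` one-link plaquettes, and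
`2·#two + #one = 6·L_d³ = 6·n_dof`. -/
theorem e7_defect_counts {L : ℕ} (hL : 1 ≤ L) :
    ∑ i : Fin 3, (twoLinkCorners 3 L i).card = 3 * ((L - 1) * L ^ 2)
      ∧ ∑ i : Fin 3, (oneLinkCorners 3 L i).card = 3 * (2 * L ^ 2)
      ∧ 2 * ∑ i : Fin 3, (twoLinkCorners 3 L i).card + ∑ i : Fin 3, (oneLinkCorners 3 L i).card = 2 * 3 * L ^ 3 :=
  ⟨sum_card_twoLinkCorners hL, sum_card_oneLinkCorners hL, two_mul_twoLinkCorners_add_oneLinkCorners hL (by norm_num)⟩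

/-- E7: the protocol-averaged weight is `3 L_d² (L_d + 1) = 3 n_dof · (1 + 1/L_d)` (vs the printed
`3 n_dof` from two-link plaquettes alone). -/
theorem e7_integral_defectProtocolWeight {L : ℕ} (hL : 1 ≤ L) :
    ∫ c in (0 : ℝ)..1, (2 * c * (∑ i : Fin 3, (twoLinkCorners 3 L i).card : ℕ)
        + (∑ i : Fin 3, (oneLinkCorners 3 L i).card : ℕ))
      = 3 * (L : ℝ) ^ 3 * (1 + 1 / L) := by
  rw [integral_defectProtocolWeight hL]
  have hL' : (L : ℝ) ≠ 0 := Nat.cast_ne_zero.mpr (by omega)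
  push_cast
  field_simp

end Summit.Ventures.LatticeQCDFlow.Scaling
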